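import Mathlib
import HarnessLib

/-!
# HANDOFF — THE LADDER GRAM: the wall criterion of the deleted window form on the full form's near-null ladder
# (cell rh-explicit, TRACK «HANDOFF», seat theory-2 gen14; FILE XII-κ; the bookkeeping under LADDER (L19″)–(L19⁗) and EDGEPROFILE §5)

HONEST FRAMING. Nothing here bears on the truth of RH; this is finite-dimensional real quadratic-form algebra. In the cell's reading
(DATA, single-lineage): on the span of the full form's near-null modes `v_k` (energies `λ_k > 0`, edge values `η_k > 0`) the q-deleted
window form is `b ↦ Σ_k λ_k b_k² + 2C·Σ_{j,k} η_j η_k Q_{jk} b_j b_k`, with `Q` the reflection Gram of the rungs' edge SHAPES and `2C·Q`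
carrying the sign of the sector (odd: one-signed; even: signature (+,−), XII-ι §2–§4). Substituting `a_k = η_k b_k` turns it into
`a ↦ Σ_k a_k²/w_k + 2C·Σ Q_{jk} a_j a_k` with `w_k = η_k²/λ_k` the PRICE at which rung `k` sells layer amplitude (kappa.py: `w_k ≈ 0.97 q`
odd, `1.14 q` even at q = 29): a wall (a negative direction) exists iff the second form has one — «contrast beats price»
(`modeForm_eq_amplitudeForm`, `exists_neg_iff`). The smallest instance, two rungs, is the discriminant criterion (`exists_neg_of_discr`,
`nonneg_of_discr`): with diagonal entries `p, s` and coupling `r`, a negative direction exists iff `p·s < r²` (given `p > 0`).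
RH-free; folklore (Sylvester's law for a diagonal congruence; the 2×2 discriminant).
-/

set_option linter.dupNamespace false  -- the mandated namespace repeats `RiemannHypothesis`

open Finset

namespace Summit.RiemannHypothesis.RiemannHypothesis.Theorems.HandoffLadderGram

variable {n : ℕ}

/-- **THE PRICE SUBSTITUTION.** The deleted form on the ladder in MODE coordinates, `Σ_k λ_k b_k² + 2C Σ_{j,k} η_j η_k Q_jk b_j b_k`,
equals, with `a_k = η_k b_k` and prices `w_k = η_k²/λ_k` (all `η_k ≠ 0`), the AMPLITUDE form `Σ_k a_k²/w_k + 2C Σ_{j,k} Q_jk a_j a_k`.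
[folklore: diagonal congruence] -/
theorem modeForm_eq_amplitudeForm (lam eta : Fin n → ℝ) (C : ℝ) (Q : Fin n → Fin n → ℝ) (b : Fin n → ℝ)
    (heta : ∀ k, eta k ≠ 0) :
    (∑ k, lam k * b k ^ 2) + 2 * C * ∑ j, ∑ k, eta j * eta k * Q j k * b j * b k
      = (∑ k, (eta k * b k) ^ 2 / (eta k ^ 2 / lam k)) + 2 * C * ∑ j, ∑ k, Q j k * (eta j * b j) * (eta k * b k) := by
  congr 1
  · refine Finset.sum_congr rfl fun k _ ↦ ?_
    by_cases hl : lam k = 0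
    · simp [hl]
    · have hk := heta k
      field_simp
  · congr 1
    refine Finset.sum_congr rfl fun j _ ↦ Finset.sum_congr rfl fun k _ ↦ ?_
    ring

/-- **CONTRAST BEATS PRICE.** A negative direction of the mode form exists iff the amplitude form `Σ a_k²/w_k + 2C·aᵀQa`
(`w_k = η_k²/λ_k`, `η_k ≠ 0`) has one: in the cell's reading the even wall of LADDER (L19″) is the event
`λ_min(diag(1/w) + 2C·Q) < 0` — every rung sells layer amplitude at the price `1/w_k`, the shape Gram `Q` supplies the contrast.
[folklore] -/
theorem exists_neg_iff (lam eta : Fin n → ℝ) (C : ℝ) (Q : Fin n → Fin n → ℝ) (heta : ∀ k, eta k ≠ 0) :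
    (∃ b : Fin n → ℝ, (∑ k, lam k * b k ^ 2) + 2 * C * ∑ j, ∑ k, eta j * eta k * Q j k * b j * b k < 0) ↔
      ∃ a : Fin n → ℝ, (∑ k, a k ^ 2 / (eta k ^ 2 / lam k)) + 2 * C * ∑ j, ∑ k, Q j k * a j * a k < 0 := by
  constructor
  · rintro ⟨b, hb⟩
    exact ⟨fun k ↦ eta k * b k, by rwa [← modeForm_eq_amplitudeForm lam eta C Q b heta]⟩
  · rintro ⟨a, ha⟩
    refine ⟨fun k ↦ a k / eta k, ?_⟩
    rw [modeForm_eq_amplitudeForm lam eta C Q _ heta]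
    have e : ∀ k, eta k * (a k / eta k) = a k := fun k ↦ mul_div_cancel₀ (a k) (heta k)
    simp only [e]
    exact ha

/-- **TWO RUNGS: THE DISCRIMINANT.** For the binary form `p x² + 2 r x y + s y²` with `p > 0`: if `p·s < r²` there is a negative direction
(take `(x, y) = (−r, p)`: value `p(ps − r²)`). In the cell's even-sector reading: two rungs with prices/self-couplings `p, s` and
cross-coupling `r` make a wall as soon as the CONTRAST `r²` exceeds `p·s`. [folklore] -/
theorem exists_neg_of_discr {p r s : ℝ} (hp : 0 < p) (h : p * s < r ^ 2) :
    ∃ x y : ℝ, p * x ^ 2 + 2 * r * (x * y) + s * y ^ 2 < 0 := by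
  refine ⟨-r, p, ?_⟩
  nlinarith [mul_pos hp (sub_pos.2 h)]

/-- … and conversely: if `r² ≤ p·s` (with `p > 0`) the binary form is nonnegative — no wall from two rungs without enough contrast:
`p·(p x² + 2 r x y + s y²) = (p x + r y)² + (p s − r²) y²`. [folklore] -/
theorem nonneg_of_discr {p r s : ℝ} (hp : 0 < p) (h : r ^ 2 ≤ p * s) (x y : ℝ) :
    0 ≤ p * x ^ 2 + 2 * r * (x * y) + s * y ^ 2 := by
  have key : p * (p * x ^ 2 + 2 * r * (x * y) + s * y ^ 2) = (p * x + r * y) ^ 2 + (p * s - r ^ 2) * y ^ 2 := by ring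
  have hnn : 0 ≤ p * (p * x ^ 2 + 2 * r * (x * y) + s * y ^ 2) := by
    rw [key]; nlinarith [sq_nonneg (p * x + r * y), mul_nonneg (sub_nonneg.2 h) (sq_nonneg y)]
  exact (mul_nonneg_iff_of_pos_left hp).mp hnn

end Summit.RiemannHypothesis.RiemannHypothesis.Theorems.HandoffLadderGram

/-!
## §2 (theory-2 gen14) TWO RUNGS OF THE LADDER: the wall criterion in closed form

For a two-rung ladder (`Fin 2`) the amplitude form of §1 is the binary form `p·a₀² + 2r·a₀a₁ + s·a₁²` with
`p = 1/w₀ + 2C·Q₀₀`, `s = 1/w₁ + 2C·Q₁₁` (price plus self-coupling of each rung) and `r = C·(Q₀₁ + Q₁₀)` (the cross-coupling, `= 2C·Q₀₁` for a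
symmetric shape Gram); so by §1's discriminant a wall exists as soon as `p·s < r²` — CONTRAST `r²` BEATS the product of the two rungs' PRICES —
and not before (`r² ≤ p·s`). In the cell's even sector this is the smallest model of LADDER (L19″): any two rungs `j < k` of the full form's
near-null ladder whose 2×2 block satisfies it already force the even deleted form negative (the n-rung statement is the same inequality on a
principal 2×2 minor; recorded here for `n = 2`). RH-free; folklore.
-/

namespace Summit.RiemannHypothesis.RiemannHypothesis.Theorems.HandoffLadderGram

/-- The two-rung amplitude form written out: `Σ_k a_k²/w_k + 2C Σ_{j,k} Q_jk a_j a_k` on `Fin 2` equals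
`p a₀² + 2 r a₀ a₁ + s a₁²` with `p = 1/w₀ + 2C Q₀₀`, `s = 1/w₁ + 2C Q₁₁`, `r = C (Q₀₁ + Q₁₀)`. [bookkeeping] -/
theorem amplitudeForm_two (w : Fin 2 → ℝ) (C : ℝ) (Q : Fin 2 → Fin 2 → ℝ) (a : Fin 2 → ℝ) :
    (∑ k, a k ^ 2 / w k) + 2 * C * ∑ j, ∑ k, Q j k * a j * a k
      = (1 / w 0 + 2 * C * Q 0 0) * a 0 ^ 2 + 2 * (C * (Q 0 1 + Q 1 0)) * (a 0 * a 1) + (1 / w 1 + 2 * C * Q 1 1) * a 1 ^ 2 := by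
  simp only [Fin.sum_univ_two]
  ring

/-- **TWO RUNGS: CONTRAST BEATS PRICE.** If rung 0's price-plus-self-coupling `p = 1/w₀ + 2CQ₀₀` is positive and
`p·(1/w₁ + 2CQ₁₁) < (C(Q₀₁ + Q₁₀))²`, the two-rung deleted form has a negative direction. [folklore: §1's discriminant on `Fin 2`] -/
theorem exists_neg_two_rungs (w : Fin 2 → ℝ) (C : ℝ) (Q : Fin 2 → Fin 2 → ℝ)
    (hp : 0 < 1 / w 0 + 2 * C * Q 0 0)
    (h : (1 / w 0 + 2 * C * Q 0 0) * (1 / w 1 + 2 * C * Q 1 1) < (C * (Q 0 1 + Q 1 0)) ^ 2) :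
    ∃ a : Fin 2 → ℝ, (∑ k, a k ^ 2 / w k) + 2 * C * ∑ j, ∑ k, Q j k * a j * a k < 0 := by
  obtain ⟨x, y, hxy⟩ := exists_neg_of_discr hp h
  refine ⟨![x, y], ?_⟩
  rw [amplitudeForm_two]
  simpa using hxy

/-- … and with too little contrast, `(C(Q₀₁ + Q₁₀))² ≤ p·s` (and `p > 0`), the two-rung deleted form is nonnegative on every amplitude
vector: no wall from these two rungs. [folklore] -/
theorem nonneg_two_rungs (w : Fin 2 → ℝ) (C : ℝ) (Q : Fin 2 → Fin 2 → ℝ)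
    (hp : 0 < 1 / w 0 + 2 * C * Q 0 0)
    (h : (C * (Q 0 1 + Q 1 0)) ^ 2 ≤ (1 / w 0 + 2 * C * Q 0 0) * (1 / w 1 + 2 * C * Q 1 1)) (a : Fin 2 → ℝ) :
    0 ≤ (∑ k, a k ^ 2 / w k) + 2 * C * ∑ j, ∑ k, Q j k * a j * a k := by
  rw [amplitudeForm_two]
  exact nonneg_of_discr hp h (a 0) (a 1)

end Summit.RiemannHypothesis.RiemannHypothesis.Theorems.HandoffLadderGram
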